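import Literature.NumberTheory.Automorphic.UnitaryGroupHeisenbergRingHaar                             -- ★ `HeisRing.heisElt ∕ heisZ ∕ heisX ∕ heisY ∕ heisHomeomorph ∕ heisHaar`
import Summits.HodgeConjecture.HodgeConjecture.Theorems.F0P3cStCharTSInvolutionRingPolarSlice           -- ★ B2 (i)+(iii) (this seat): `skewLineIntegral_eq_zero_of_eigen_unit` (`J_h = 0`); brings FILE 1, ★ B2 (ii), ★ B1
import Mathlib.MeasureTheory.Integral.Prod
import HarnessLib

/-!
# F0 · P3c · line LH6 «StCharTS» — «HEISENBERG ANNULUS SLICE★» (ROAD «KEYS3-ANALYTIC», LEAD T15-03; brick B3 of MEMO v3 §2): in the Heisenberg chart `u(x, z)`, `z = y − ½ x σx`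
# (`y ∈ R⁻`), of the unipotent radical `N` of `U(Φ₃)`, the integral of `(nrm z)⁻¹ • h(z)` over the annulus `{A/‖α‖² < nrm z ≤ A}` against `μ_R ⊗ μ_{R⁻}` SLICES along the fibres
# `y = l_x·η`, `l_x = −½xσx`, into `(√nrm ½)⁻¹ · V_X · J_h`, `J_h = ∫_{R⁻} (nrm (1+η))⁻¹ • h(1+η) dη` — the `x`-variable runs over a fundamental domain of `α^ℤ` for `(nrm x)⁻¹dx` and
# integrates to the CONSTANT `V_X`; no norm-class density, no case split [Rogawski1990 §1.10, §12.2; Keys1984 §7; TateThesis1967 §2; WeilBNT1967 VII §2]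

Cell `pub/hodgecm-mathlib`, crux H413 = `stmt-HodgeConjecture-24833` (lane `--supports … --as helper`), route HCCMUnconditional; seat F0P2-p06 (g21), ROAD «KEYS3-ANALYTIC» (LEAD
F0P3a-plan (g16) T15-03 «GO»; MEMO `F0/P2/F0P2-p06/g21/MEMO-KEYS3-analytic-road.v3` §2).  THEOREMS ONLY (0 def ∕ 0 instance ∕ 0 notation ∕ 0 sorry).  FRAME = ★ `HeisRing`
(`UnitaryGroupHeisenbergRing{,Haar}`, `InvolutionRingFixedDecomposition`: `R` commutative locally compact T2 second countable Borel, `σ` continuous involution, `[Invertible (2 : R)]`,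
a skew unit `δ`, `J = Φ₃`) + the «norm» `nrm : R → ℝ≥0` of ★ B2 (`nrm (u b) = ‖u‖_R nrm b`, `nrm 1 = 1`, `nrm (σ b) = nrm b`, measurable).  No field ∕ valuation ∕ residue characteristic
in any STATEMENT (T15-03 (k1)).  With ★ B2 `skewLineIntegral_eq_zero_of_eigen_unit` (`J_h = 0`) the annulus integral VANISHES (`integral_annulus_heisZ_eq_zero_of_eigen_unit`) — the
analytic heart of `hKeysRed3` (MEMO v3 §1: `Λ(g₀(m)) = ±χ(m)·(annulus integral)`; B4–B6 dress it on `U(Φ₃)(L⁺_v)`).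
* §1 algebra of the fibre: `l_x = −½xσx` is a `σ`-fixed unit, `heisZ x (l_x η) = l_x (1 + η)`, `nrm l_x = nrm ½ · (nrm x)²`, `nrm (−b) = nrm b`.
* §2 **`integral_annulus_heisZ_eq_shellMass_smul_skewLineIntegral`** (the slice, on `μ_R ⊗ μ_{R⁻}`) and **`integral_annulus_heisZ_eq_zero_of_eigen_unit`** (+ ★ B2: `= 0`).
* §3 `heisZ_heisX_heisY` (`z(u) = u₀₂`) and the same two statements on `N` against ★ `heisHaar`.
HONEST LABEL: HC_CM is proved only modulo the 7 printed citations (2 remaining named inputs: hLiu418 = `stmt-HodgeConjecture-24832`, h413 = `stmt-HodgeConjecture-24833`) until rung 0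
closes; count-neutral.

## References
* [Rogawski1990] J. D. Rogawski, *Automorphic Representations of Unitary Groups in Three Variables* (1990), §1.10 p. 9 (`N = {u(x, z)}`), §12.2 pp. 173–174.
* [Keys1984] D. Keys, Compositio Math. 51 (1984), §7 Thm. (1).
* [TateThesis1967] J. Tate, in Cassels–Fröhlich (1967), §2.2–2.4.  [WeilBNT1967] A. Weil, *Basic Number Theory* (1967), Ch. I §2, Ch. VII §2.
-/

set_option autoImplicit false
-- the mandated namespace has the single-problem summit's repeated segment (`HodgeConjecture.HodgeConjecture`)
set_option linter.dupNamespace false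

noncomputable section

open MeasureTheory Set
open scoped Pointwise NNReal ENNReal
open Literature.NumberTheory.Automorphic Literature.NumberTheory.Automorphic.UnitaryGroup Literature.NumberTheory.Automorphic.UnitaryGroup.HeisRing
open Summit.HodgeConjecture.HodgeConjecture.Cruxes.H413.F0P3cStCharTSHeightShellFundamentalDomain
open Summit.HodgeConjecture.HodgeConjecture.Cruxes.H413.F0P3cStCharTSModulusShellCharacterVanishing
open Summit.HodgeConjecture.HodgeConjecture.Cruxes.H413.F0P3cStCharTSInvolutionRingPolarSliceShells
open Summit.HodgeConjecture.HodgeConjecture.Cruxes.H413.F0P3cStCharTSInvolutionRingPolarSlice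

namespace Summit.HodgeConjecture.HodgeConjecture.Cruxes.H413.F0P3cStCharTSHeisenbergAnnulusSlice

variable {R : Type*} [CommRing R] [TopologicalSpace R] [IsTopologicalRing R] [LocallyCompactSpace R] [T2Space R] [SecondCountableTopology R]
  [MeasurableSpace R] [BorelSpace R] (σ : R →+* R) (hσ : ∀ x, σ (σ x) = x) (hσc : Continuous σ) [Invertible (2 : R)]

/-! ## §1 The fixed unit `l_x = −½ x σx` and the `z`-coordinate along the fibre `y = l_x · η` -/

section Algebra

variable {nrm : R → ℝ≥0} (hmul : ∀ (u : Rˣ) (b : R), nrm ((u : R) * b) = distribHaarChar R u * nrm b) (hone : nrm 1 = 1) (hnσ : ∀ b, nrm (σ b) = nrm b)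

omit [TopologicalSpace R] [IsTopologicalRing R] [LocallyCompactSpace R] [T2Space R] [SecondCountableTopology R] [MeasurableSpace R] [BorelSpace R] in
/-- `l_x := −½ x σx` is a unit for a unit `x` (`2 ∈ Rˣ`). [cite: Rogawski1990, §1.10 p. 9] -/
theorem isUnit_halfNorm {x : R} (hx : IsUnit x) : IsUnit (-(⅟(2 : R) * (x * σ x))) :=
  ((isUnit_of_invertible (⅟(2 : R))).mul (hx.mul (hx.map σ))).neg

omit [TopologicalSpace R] [IsTopologicalRing R] [LocallyCompactSpace R] [T2Space R] [SecondCountableTopology R] [MeasurableSpace R] [BorelSpace R] in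
include hσ in
/-- `l_x = −½ x σx` is `σ`-fixed. [cite: Rogawski1990, §1.10 p. 9] -/
theorem map_halfNorm (x : R) : σ (-(⅟(2 : R) * (x * σ x))) = -(⅟(2 : R) * (x * σ x)) := by
  rw [map_neg, map_mul, map_mul, map_invOf_two σ, hσ, mul_comm (σ x) x]

omit [TopologicalSpace R] [IsTopologicalRing R] [LocallyCompactSpace R] [T2Space R] [SecondCountableTopology R] [MeasurableSpace R] [BorelSpace R] in
/-- Along the fibre `y = l_x η`: `z = heisZ x (l_x η) = l_x · (1 + η)`. [cite: Rogawski1990, §1.10 p. 9] -/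
theorem heisZ_fibre (x η : R) : heisZ σ x (-(⅟(2 : R) * (x * σ x)) * η) = -(⅟(2 : R) * (x * σ x)) * (1 + η) := by
  simp only [heisZ]; ring

omit [T2Space R] [SecondCountableTopology R] [MeasurableSpace R] [BorelSpace R] [Invertible (2 : R)] in
include hmul in
/-- `nrm (−b) = nrm b` (`‖−1‖_R = 1`). [cite: WeilBNT1967, Ch. I §2] -/
theorem nrm_neg (b : R) : nrm (-b) = nrm b := by
  have h1 : distribHaarChar R (-1 : Rˣ) * distribHaarChar R (-1 : Rˣ) = 1 := by rw [← map_mul, neg_one_mul, neg_neg, map_one]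
  have h2 : distribHaarChar R (-1 : Rˣ) = 1 := by
    have := congrArg NNReal.sqrt h1
    rwa [NNReal.sqrt_mul_self, NNReal.sqrt_one] at this
  have h := hmul (-1) b
  rwa [Units.val_neg, Units.val_one, neg_one_mul, h2, one_mul] at h

omit [T2Space R] [SecondCountableTopology R] [MeasurableSpace R] [BorelSpace R] in
include hmul hone hnσ in
/-- **`nrm l_x = nrm ½ · (nrm x)²`** for a unit `x`. [cite: WeilBNT1967, Ch. I §2] -/
theorem nrm_halfNorm {x : R} (hx : IsUnit x) : nrm (-(⅟(2 : R) * (x * σ x))) = nrm (⅟(2 : R)) * (nrm x * nrm x) := by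
  rw [nrm_neg hmul, nrm_mul_of_isUnit hmul hone (isUnit_of_invertible (⅟(2 : R))), nrm_mul_of_isUnit hmul hone hx, hnσ]

end Algebra

/-! ## §2 The annulus slice on `μ_R ⊗ μ_{R⁻}` -/

section Slice

variable (μX : Measure R) [μX.IsAddHaarMeasure] (μY : Measure (skewPart σ)) [μY.IsAddHaarMeasure] [μY.Regular]
  {nrm : R → ℝ≥0} (hnm : Measurable nrm) (hmul : ∀ (u : Rˣ) (b : R), nrm ((u : R) * b) = distribHaarChar R u * nrm b) (hone : nrm 1 = 1)
  (hnσ : ∀ b, nrm (σ b) = nrm b)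

include hσ hσc hnm hmul hone hnσ in
/-- **«HEISENBERG ANNULUS SLICE».**  `Q = ‖α‖_R > 1`, `1 + η ∈ Rˣ` for every `η ∈ R⁻`, `μ_R`-a.e. `x` a unit, a skew unit `δ`, `h : R → E` measurable bounded and invariant under `σ`-FIXED units,
the chart-annulus `{(x, y) : nrm (heisZ x y) ≤ A}` compact.  Then, with `S = {A/Q² < nrm ≤ A}`,
  `∫_{μ_R ⊗ μ_{R⁻}} 𝟙_S(z) (nrm z)⁻¹ • h(z)`, `z = heisZ x y = y − ½xσx`, `= ((√nrm ½)⁻¹ · V_X) • ∫_{R⁻} (nrm (1+η))⁻¹ • h(1+η) dμ_{R⁻}(η)`,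
`V_X = ν_X{B₀/Q² < nrm² ≤ B₀}` the (shell-independent) mass of a `nrm²`-shell for `ν_X = nrm⁻¹·μ_R` (★ B2 (ii) invariance + ★ B1).  Substitution `y = l_x η` (`l_x = −½xσx`, Jacobian
`χ⁻(l_x) = √nrm l_x`, ★ B2 FILE 1), Fubini via Tonelli through the substitution, shell independence. [cite: Rogawski1990, §12.2 pp. 173–174] [cite: Keys1984, §7 Thm. (1)]
[cite: TateThesis1967, §2.2–2.4] [cite: WeilBNT1967, Ch. VII §2] -/
theorem integral_annulus_heisZ_eq_shellMass_smul_skewLineIntegral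
    {E : Type*} [NormedAddCommGroup E] [NormedSpace ℝ E] [CompleteSpace E] [SecondCountableTopology E] [MeasurableSpace E] [BorelSpace E]
    (δ : Rˣ) (hδ : σ (δ : R) = -δ) (α : Rˣ) (hQ : 1 < distribHaarChar R α)
    (hη : ∀ η : skewPart σ, IsUnit (1 + (η : R))) (hunit : ∀ᵐ x ∂μX, IsUnit x)
    {A : ℝ} (hA : 0 < A) (hcpt : IsCompact {p : R × skewPart σ | (nrm (heisZ σ p.1 (p.2 : R)) : ℝ) ≤ A}) {B₀ : ℝ} (hB₀ : 0 < B₀)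
    (h : R → E) (hhm : Measurable h) {C : ℝ} (hhb : ∀ b, ‖h b‖ ≤ C) (hhs : ∀ (s : Rˣ), σ (s : R) = s → ∀ b, h ((s : R) * b) = h b) :
    ∫ p, ((fun b : R => (nrm b : ℝ)) ⁻¹' Set.Ioc (A / ((distribHaarChar R α : ℝ) ^ 2)) A).indicator (fun b => ((nrm b)⁻¹ : ℝ≥0) • h b) (heisZ σ p.1 (p.2 : R))
        ∂(μX.prod μY) =
      (((NNReal.sqrt (nrm (⅟(2 : R))))⁻¹ : ℝ) *
        ((μX.withDensity fun x => ((nrm x)⁻¹ : ℝ≥0)) ((fun x : R => (nrm x : ℝ) ^ 2) ⁻¹' Set.Ioc (B₀ / ((distribHaarChar R α : ℝ) ^ 2)) B₀)).toReal) •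
        ∫ η, ((nrm (1 + (η : R)))⁻¹ : ℝ≥0) • h (1 + (η : R)) ∂μY := by
  haveI := locallyCompactSpace_skewPart σ hσc
  haveI : SecondCountableTopology (skewPart σ) := TopologicalSpace.Subtype.secondCountableTopology _
  -- notation
  set Q : ℝ≥0 := distribHaarChar R α with hQdef
  have hQ0 : (0 : ℝ) < (Q : ℝ) := by exact_mod_cast lt_trans zero_lt_one hQ
  have hQ2 : (0 : ℝ) < (Q : ℝ) ^ 2 := pow_pos hQ0 2
  have hQ21 : (1 : ℝ) < (Q : ℝ) ^ 2 := by
    have h1 : (1 : ℝ) < (Q : ℝ) := by exact_mod_cast hQ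
    nlinarith
  set c2 : ℝ≥0 := nrm (⅟(2 : R)) with hc2def
  have hc2pos : 0 < c2 := nrm_pos_of_isUnit hmul hone (isUnit_of_invertible (⅟(2 : R)))
  have hc20 : (0 : ℝ) < (c2 : ℝ) := by exact_mod_cast hc2pos
  set S : Set R := (fun b : R => (nrm b : ℝ)) ⁻¹' Set.Ioc (A / ((Q : ℝ) ^ 2)) A with hSdef
  have hnmR : Measurable (fun b : R => (nrm b : ℝ)) := NNReal.continuous_coe.measurable.comp hnm
  have hS : MeasurableSet S := hnmR measurableSet_Ioc
  set Φ : R → E := fun b => ((nrm b)⁻¹ : ℝ≥0) • h b with hΦdef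
  have hΦm : Measurable Φ := (hnm.inv.coe_nnreal_real).smul hhm
  set n1 : skewPart σ → ℝ≥0 := fun η => nrm (1 + (η : R)) with hn1def
  have hn1m : Measurable n1 := hnm.comp (measurable_const.add measurable_subtype_coe)
  have hn1pos : ∀ η, 0 < n1 η := fun η => nrm_pos_of_isUnit hmul hone (hη η)
  set ψ : skewPart σ → E := fun η => ((n1 η)⁻¹ : ℝ≥0) • h (1 + (η : R)) with hψdef
  have hψm : Measurable ψ := (hn1m.inv.coe_nnreal_real).smul (hhm.comp (measurable_const.add measurable_subtype_coe))
  set ν := μX.withDensity (fun x => (((nrm x)⁻¹ : ℝ≥0) : ℝ≥0∞)) with hνdef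
  -- the `x`-shells (height `nrm²`, ratio `Q²`) and their common mass
  set T : ℝ → Set R := fun B => (fun x : R => (nrm x : ℝ) ^ 2) ⁻¹' Set.Ioc (B / ((Q : ℝ) ^ 2)) B with hTdef
  have hm2 : Measurable (fun x : R => (nrm x : ℝ) ^ 2) := hnmR.pow_const 2
  have hTm : ∀ B, MeasurableSet (T B) := fun B => hm2 measurableSet_Ioc
  have hposX : ∀ᵐ x ∂μX, 0 < nrm x := hunit.mono fun x hx => nrm_pos_of_isUnit hmul hone hx
  have hV : ∀ B, 0 < B → ν (T B) = ν (T B₀) := by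
    intro B hB
    haveI := smulInvariantMeasure_zpowers_units μX hnm hmul α
    have hscale : ∀ x : R, (nrm (α • x) : ℝ) ^ 2 = ((Q : ℝ) ^ 2) * ((nrm x : ℝ) ^ 2) := by
      intro x; rw [coe_nrm_units_smul hmul α x]; ring
    have hposν : ∀ᵐ x ∂ν, 0 < (nrm x : ℝ) ^ 2 :=
      withDensity_absolutelyContinuous μX _ (hposX.mono fun x hx => by positivity)
    exact measure_heightShell_eq ν hQ21 hscale hposν hB hB₀ (hTm _).nullMeasurableSet (hTm _).nullMeasurableSet
  -- Step A: integrability of `𝟙_S Φ ∘ z` for `μX ⊗ μY`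
  set zc : R × skewPart σ → R := fun p => heisZ σ p.1 (p.2 : R) with hzcdef
  have hzcm : Measurable zc := by
    have hc : Continuous zc := (continuous_subtype_val.comp continuous_snd).sub
      (continuous_const.mul ((continuous_fst).mul (hσc.comp continuous_fst)))
    exact hc.measurable
  have hbound : ∀ b ∈ S, ‖Φ b‖ ≤ (Q : ℝ) ^ 2 / A * C := by
    intro b hb
    have hb1 : A / ((Q : ℝ) ^ 2) < (nrm b : ℝ) := hb.1
    have hnb : 0 < (nrm b : ℝ) := lt_trans (div_pos hA hQ2) hb1
    have hinv : ((nrm b : ℝ))⁻¹ ≤ (Q : ℝ) ^ 2 / A := by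
      rw [inv_le_comm₀ hnb (div_pos hQ2 hA), inv_div]; exact hb1.le
    change ‖((nrm b)⁻¹ : ℝ≥0) • h b‖ ≤ _
    rw [NNReal.smul_def, norm_smul, Real.norm_of_nonneg (NNReal.coe_nonneg _), NNReal.coe_inv]
    exact mul_le_mul hinv (hhb b) (norm_nonneg _) (le_of_lt (div_pos hQ2 hA))
  have hmeasP : Measurable (fun p : R × skewPart σ => S.indicator Φ (zc p)) := (hΦm.indicator hS).comp hzcm
  have hsuppP : Function.support (fun p : R × skewPart σ => S.indicator Φ (zc p)) ⊆ {p | (nrm (heisZ σ p.1 (p.2 : R)) : ℝ) ≤ A} := by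
    intro p hp
    rw [Function.mem_support] at hp
    have hmem : zc p ∈ S := by
      by_contra hnot; exact hp (Set.indicator_of_notMem hnot _)
    exact hmem.2
  haveI : (μX.prod μY).IsAddHaarMeasure := inferInstance
  have hC0 : 0 ≤ C := le_trans (norm_nonneg _) (hhb 0)
  have hM0 : 0 ≤ (Q : ℝ) ^ 2 / A * C := mul_nonneg (le_of_lt (div_pos hQ2 hA)) hC0
  have hbound' : ∀ p : R × skewPart σ, ‖S.indicator Φ (zc p)‖ ≤ (Q : ℝ) ^ 2 / A * C := by
    intro p
    by_cases hp : zc p ∈ S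
    · rw [Set.indicator_of_mem hp]; exact hbound _ hp
    · rw [Set.indicator_of_notMem hp, norm_zero]; exact hM0
  have hKcm : MeasurableSet {p : R × skewPart σ | (nrm (heisZ σ p.1 (p.2 : R)) : ℝ) ≤ A} := (hnmR.comp hzcm) measurableSet_Iic
  have hintP : Integrable (fun p : R × skewPart σ => S.indicator Φ (zc p)) (μX.prod μY) := by
    refine IntegrableOn.integrable_of_forall_notMem_eq_zero (s := {p : R × skewPart σ | (nrm (heisZ σ p.1 (p.2 : R)) : ℝ) ≤ A}) ?_ ?_
    · exact Measure.integrableOn_of_bounded hcpt.measure_lt_top.ne hmeasP.aestronglyMeasurable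
        ((ae_restrict_iff' hKcm).2 (Filter.Eventually.of_forall fun p _ => hbound' p))
    · intro p hp
      exact Function.notMem_support.1 fun h' => hp (hsuppP h')
  -- Step B/C: Fubini on the product
  have hLHS : ∫ p, S.indicator Φ (zc p) ∂(μX.prod μY) = ∫ x, ∫ y, S.indicator Φ (heisZ σ x (y : R)) ∂μY ∂μX := integral_prod _ hintP
  -- the swapped integrand `G(x, η) = (√c2)⁻¹ • 𝟙[x ∈ T(A / (c2 · nrm(1+η)))] (nrm x)⁻¹ • ψ η`
  set Bη : skewPart σ → ℝ := fun η => A / ((c2 : ℝ) * (n1 η : ℝ)) with hBηdef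
  have hBηm : Measurable Bη := measurable_const.div (measurable_const.mul (NNReal.continuous_coe.measurable.comp hn1m))
  have hBηpos : ∀ η, 0 < Bη η := fun η => div_pos hA (mul_pos hc20 (by exact_mod_cast hn1pos η))
  set K : Set (R × skewPart σ) := {p | p.1 ∈ T (Bη p.2)} with hKdef
  have hK : MeasurableSet K := by
    have h1 : Measurable fun p : R × skewPart σ => (nrm p.1 : ℝ) ^ 2 := hm2.comp measurable_fst
    have h2 : Measurable fun p : R × skewPart σ => Bη p.2 := hBηm.comp measurable_snd
    have h3 : Measurable fun p : R × skewPart σ => Bη p.2 / ((Q : ℝ) ^ 2) := h2.div_const _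
    have hK' : K = {p | Bη p.2 / ((Q : ℝ) ^ 2) < (nrm p.1 : ℝ) ^ 2} ∩ {p | (nrm p.1 : ℝ) ^ 2 ≤ Bη p.2} := by
      ext p; simp only [hKdef, hTdef, Set.mem_setOf_eq, Set.mem_preimage, Set.mem_Ioc, Set.mem_inter_iff]
    rw [hK']
    exact (measurableSet_lt h3 h1).inter (measurableSet_le h1 h2)
  set c2i : ℝ := (((NNReal.sqrt c2)⁻¹ : ℝ≥0) : ℝ) with hc2idef
  set G : R × skewPart σ → E := fun p => c2i • ((K.indicator (fun p => ((nrm p.1)⁻¹ : ℝ≥0) : R × skewPart σ → ℝ) p) • ψ p.2) with hGdef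
  have hdensm : Measurable (fun x : R => ((nrm x)⁻¹ : ℝ≥0)) := hnm.inv
  have hGm : Measurable G :=
    (((NNReal.continuous_coe.measurable.comp (hdensm.comp measurable_fst)).indicator hK).smul (hψm.comp measurable_snd)).const_smul _
  -- Step D: the pointwise identity behind the fibrewise substitution `y = l_x η` at a unit `x`
  have hlu : ∀ (x : R) (hx : IsUnit x), IsUnit (-(⅟(2 : R) * (x * σ x))) := fun x hx => isUnit_halfNorm σ hx
  have hlfix : ∀ (x : R) (hx : IsUnit x), σ (((hlu x hx).unit : Rˣ) : R) = (hlu x hx).unit := fun x hx => by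
    rw [(hlu x hx).unit_spec]; exact map_halfNorm σ hσ x
  have hpt : ∀ (x : R) (hx : IsUnit x) (η : skewPart σ),
      (skewModulus σ hσc (hlu x hx).unit (hlfix x hx) : ℝ) • S.indicator Φ (heisZ σ x ((smulSkew σ (hlu x hx).unit (hlfix x hx) η : skewPart σ) : R)) = G (x, η) := by
    intro x hx η
    have hl := hlu x hx
    have hz : heisZ σ x ((smulSkew σ hl.unit (hlfix x hx) η : skewPart σ) : R) = (hl.unit : R) * (1 + (η : R)) := by
      rw [coe_smulSkew, hl.unit_spec, heisZ_fibre]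
    have hnl : nrm ((hl.unit : Rˣ) : R) = c2 * (nrm x * nrm x) := by rw [hl.unit_spec]; exact nrm_halfNorm σ hmul hone hnσ hx
    have hnprod : nrm (((hl.unit : Rˣ) : R) * (1 + (η : R))) = c2 * (nrm x * nrm x) * n1 η := by
      rw [nrm_mul_of_isUnit hmul hone (Units.isUnit _), hnl]
    have hn : (0 : ℝ) < (n1 η : ℝ) := by exact_mod_cast hn1pos η
    have hmem : ((((hl.unit : Rˣ) : R) * (1 + (η : R))) ∈ S) ↔ (x, η) ∈ K := by
      change (nrm (((hl.unit : Rˣ) : R) * (1 + (η : R))) : ℝ) ∈ Set.Ioc (A / ((Q : ℝ) ^ 2)) A ↔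
        (nrm x : ℝ) ^ 2 ∈ Set.Ioc (A / ((c2 : ℝ) * (n1 η : ℝ)) / ((Q : ℝ) ^ 2)) (A / ((c2 : ℝ) * (n1 η : ℝ)))
      have hcn : (0 : ℝ) < (c2 : ℝ) * (n1 η : ℝ) := mul_pos hc20 hn
      rw [hnprod, NNReal.coe_mul, NNReal.coe_mul, NNReal.coe_mul, Set.mem_Ioc, Set.mem_Ioc,
        show (c2 : ℝ) * ((nrm x : ℝ) * (nrm x : ℝ)) * (n1 η : ℝ) = ((nrm x : ℝ) ^ 2) * ((c2 : ℝ) * (n1 η : ℝ)) by ring,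
        div_right_comm, div_lt_iff₀ hcn, le_div_iff₀ hcn]
    have hh1 : h (((hl.unit : Rˣ) : R) * (1 + (η : R))) = h (1 + (η : R)) := hhs hl.unit (hlfix x hx) _
    have hd : (skewModulus σ hσc hl.unit (hlfix x hx) : ℝ) * ((c2 : ℝ) * ((nrm x : ℝ) * (nrm x : ℝ)))⁻¹ = c2i * ((nrm x : ℝ))⁻¹ := by
      have := skewModulus_mul_inv_nrm σ hσ hσc hmul hone δ hδ hl.unit (hlfix x hx)
      rw [hnl, NNReal.sqrt_mul, NNReal.sqrt_mul_self] at this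
      have := congrArg (fun t : ℝ≥0 => (t : ℝ)) this
      simp only [NNReal.coe_mul, NNReal.coe_inv] at this
      rw [hc2idef, NNReal.coe_inv, ← mul_inv]
      exact this
    rw [hz]
    by_cases hsK : (x, η) ∈ K
    · have hbS : ((hl.unit : Rˣ) : R) * (1 + (η : R)) ∈ S := hmem.2 hsK
      rw [Set.indicator_of_mem hbS]
      change (skewModulus σ hσc hl.unit (hlfix x hx) : ℝ) • ((((nrm (((hl.unit : Rˣ) : R) * (1 + (η : R))))⁻¹ : ℝ≥0)) • h (((hl.unit : Rˣ) : R) * (1 + (η : R)))) =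
        c2i • ((K.indicator (fun p => ((nrm p.1)⁻¹ : ℝ≥0) : R × skewPart σ → ℝ) (x, η)) • ((((n1 η)⁻¹ : ℝ≥0)) • h (1 + (η : R))))
      rw [Set.indicator_of_mem hsK, hh1, hnprod, NNReal.smul_def, NNReal.smul_def, smul_smul, smul_smul, smul_smul]
      congr 1
      push_cast
      rw [mul_inv, ← mul_assoc, hd]
    · have hbS : ((hl.unit : Rˣ) : R) * (1 + (η : R)) ∉ S := fun hb => hsK (hmem.1 hb)
      rw [Set.indicator_of_notMem hbS, smul_zero]
      change (0 : E) = c2i • ((K.indicator (fun p => ((nrm p.1)⁻¹ : ℝ≥0) : R × skewPart σ → ℝ) (x, η)) • ψ η)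
      rw [Set.indicator_of_notMem hsK, zero_smul, smul_zero]
  have hsub : ∀ x : R, IsUnit x → ∫ y, S.indicator Φ (heisZ σ x (y : R)) ∂μY = ∫ η, G (x, η) ∂μY := by
    intro x hx
    rw [integral_eq_skewModulus_smul_integral_comp_smulSkew σ hσc μY (hlu x hx).unit (hlfix x hx), ← integral_smul]
    exact integral_congr_ae (Filter.Eventually.of_forall fun η => hpt x hx η)
  have hsubL : ∀ x : R, IsUnit x → ∫⁻ y, ‖S.indicator Φ (heisZ σ x (y : R))‖ₑ ∂μY = ∫⁻ η, ‖G (x, η)‖ₑ ∂μY := by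
    intro x hx
    rw [lintegral_eq_skewModulus_mul_lintegral_comp_smulSkew σ hσc μY (hlu x hx).unit (hlfix x hx), ← lintegral_const_mul' _ _ ENNReal.coe_ne_top]
    refine lintegral_congr fun η => ?_
    rw [← hpt x hx η, enorm_smul, Real.enorm_eq_ofReal (NNReal.coe_nonneg _), ENNReal.ofReal_coe_nnreal]
  -- Step E/F: integrability of `G` (Tonelli through the substitution) and the swap
  have hGint : Integrable G (μX.prod μY) := by
    refine ⟨hGm.aestronglyMeasurable, ?_⟩
    have hF := hintP.hasFiniteIntegral
    unfold HasFiniteIntegral at hF ⊢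
    rw [lintegral_prod _ hGm.aestronglyMeasurable.enorm]
    rw [lintegral_prod _ hintP.aestronglyMeasurable.enorm] at hF
    calc ∫⁻ x, ∫⁻ η, ‖G (x, η)‖ₑ ∂μY ∂μX = ∫⁻ x, ∫⁻ y, ‖S.indicator Φ (heisZ σ x (y : R))‖ₑ ∂μY ∂μX :=
          lintegral_congr_ae (hunit.mono fun x hx => (hsubL x hx).symm)
      _ < ⊤ := hF
  have hswap : ∫ x, ∫ η, G (x, η) ∂μY ∂μX = ∫ η, ∫ x, G (x, η) ∂μX ∂μY :=
    integral_integral_swap (by simpa [Function.uncurry_def] using hGint)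
  -- Step G: the inner `x`-integral is the shell mass, for EVERY `η`
  have hinner : ∀ η : skewPart σ, ∫ x, G (x, η) ∂μX = (c2i * (ν (T B₀)).toReal) • ψ η := by
    intro η
    have hind : ∀ x : R, (K.indicator (fun p => ((nrm p.1)⁻¹ : ℝ≥0) : R × skewPart σ → ℝ) (x, η)) =
        (T (Bη η)).indicator (fun x' : R => (((nrm x')⁻¹ : ℝ≥0) : ℝ)) x := by
      intro x
      by_cases hx : x ∈ T (Bη η)
      · rw [Set.indicator_of_mem hx, Set.indicator_of_mem (show (x, η) ∈ K from hx)]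
      · rw [Set.indicator_of_notMem hx, Set.indicator_of_notMem (show (x, η) ∉ K from hx)]
    calc ∫ x, G (x, η) ∂μX = ∫ x, c2i • ((K.indicator (fun p => ((nrm p.1)⁻¹ : ℝ≥0) : R × skewPart σ → ℝ) (x, η)) • ψ η) ∂μX := rfl
      _ = c2i • ∫ x, (K.indicator (fun p => ((nrm p.1)⁻¹ : ℝ≥0) : R × skewPart σ → ℝ) (x, η)) • ψ η ∂μX := integral_smul _ _
      _ = c2i • ((∫ x, (K.indicator (fun p => ((nrm p.1)⁻¹ : ℝ≥0) : R × skewPart σ → ℝ) (x, η)) ∂μX) • ψ η) := by rw [integral_smul_const]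
      _ = c2i • ((∫ x in T (Bη η), (((nrm x)⁻¹ : ℝ≥0) : ℝ) ∂μX) • ψ η) := by simp_rw [hind]; rw [integral_indicator (hTm _)]
      _ = c2i • ((ν (T (Bη η))).toReal • ψ η) := by
          congr 2
          rw [integral_eq_lintegral_of_nonneg_ae (Filter.Eventually.of_forall fun x => NNReal.coe_nonneg _)
            ((NNReal.continuous_coe.measurable.comp hdensm).aestronglyMeasurable), hνdef, withDensity_apply _ (hTm _)]
          simp_rw [ENNReal.ofReal_coe_nnreal]
      _ = (c2i * (ν (T B₀)).toReal) • ψ η := by rw [hV _ (hBηpos η), smul_smul]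
  -- Step H: assemble
  rw [hLHS, integral_congr_ae (hunit.mono fun x hx => hsub x hx), hswap]
  simp_rw [hinner]
  exact integral_smul _ _


include hσ hσc hnm hmul hone hnσ in
/-- **«THE ANNULUS INTEGRAL VANISHES» (MEMO v3 §2 + §3): `∫_{μ_R ⊗ μ_{R⁻}} 𝟙_{A/Q² < nrm z ≤ A} (nrm z)⁻¹ • h(z) = 0`**, `z = y − ½xσx`, for `h` measurable, bounded, invariant under the
`σ`-FIXED units and rescaled by `c ≠ 1` under some unit `b₀` — the slice (`= C • J_h`) and ★ B2 `skewLineIntegral_eq_zero_of_eigen_unit` (`J_h = 0`).  For `h(b) = χ₁(σ b̂)⁻¹` with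
`χ₁|_{(R⁺)×} = 1`, `χ₁ ≠ 1` this is the vanishing of the cell integral behind `hKeysRed3` (MEMO v3 §1), uniformly in the ramification. [cite: Keys1984, §7 Thm. (1)]
[cite: Rogawski1990, §12.2 pp. 173–174] [cite: TateThesis1967, §2.4] -/
theorem integral_annulus_heisZ_eq_zero_of_eigen_unit
    {𝕜 : Type*} [RCLike 𝕜] {E : Type*} [NormedAddCommGroup E] [NormedSpace ℝ E] [NormedSpace 𝕜 E] [CompleteSpace E] [SecondCountableTopology E]
    [MeasurableSpace E] [BorelSpace E]
    (μp : Measure (fixedPart σ)) [μp.IsAddHaarMeasure] [μp.Regular]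
    (δ : Rˣ) (hδ : σ (δ : R) = -δ) (α : Rˣ) (hQ : 1 < distribHaarChar R α)
    (hη : ∀ η : skewPart σ, IsUnit (1 + (η : R))) (hunit : ∀ᵐ x ∂μX, IsUnit x) (hunitp : ∀ᵐ s ∂μp, IsUnit ((s : fixedPart σ) : R))
    (hposR : ∀ μ : Measure R, μ.IsAddHaarMeasure → ∀ᵐ b ∂μ, 0 < nrm b)
    {A : ℝ} (hA : 0 < A) (hcpt : IsCompact {p : R × skewPart σ | (nrm (heisZ σ p.1 (p.2 : R)) : ℝ) ≤ A}) (hcptR : IsCompact {b : R | (nrm b : ℝ) ≤ A})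
    (h : R → E) (hhm : Measurable h) {C : ℝ} (hhb : ∀ b, ‖h b‖ ≤ C) (hhs : ∀ (s : Rˣ), σ (s : R) = s → ∀ b, h ((s : R) * b) = h b)
    {b₀ : Rˣ} {c : 𝕜} (hc : c ≠ 1) (hb₀ : ∀ b, h ((b₀ : R) * b) = c • h b) :
    ∫ p, ((fun b : R => (nrm b : ℝ)) ⁻¹' Set.Ioc (A / ((distribHaarChar R α : ℝ) ^ 2)) A).indicator (fun b => ((nrm b)⁻¹ : ℝ≥0) • h b) (heisZ σ p.1 (p.2 : R))
        ∂(μX.prod μY) = 0 := by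
  -- the `σ`-fixed unit `l₀ = α σα` has module `‖α‖² > 1`
  have hl₀ : σ (((α * Units.map (σ : R →* R) α : Rˣ)) : R) = (α * Units.map (σ : R →* R) α : Rˣ) := by
    rw [Units.val_mul, Units.coe_map, MonoidHom.coe_coe, map_mul, hσ, mul_comm]
  have hQ' : 1 < distribHaarChar R (α * Units.map (σ : R →* R) α) := by
    have hα : distribHaarChar R (Units.map (σ : R →* R) α) = distribHaarChar R α := by
      have h1 := hmul (Units.map (σ : R →* R) α) 1
      rw [mul_one, hone, mul_one, Units.coe_map, MonoidHom.coe_coe, hnσ, nrm_units hmul hone] at h1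
      exact h1.symm
    rw [map_mul, hα]
    exact one_lt_mul'' hQ hQ
  have hJ0 := skewLineIntegral_eq_zero_of_eigen_unit σ hσ hσc μp μY hnm hmul hone δ hδ (α * Units.map (σ : R →* R) α) hl₀ hQ' hη hunitp hposR hA hcptR
    h hhm hhb hhs hc hb₀
  rw [integral_annulus_heisZ_eq_shellMass_smul_skewLineIntegral σ hσ hσc μX μY hnm hmul hone hnσ δ hδ α hQ hη hunit hA hcpt hA h hhm hhb hhs, hJ0, smul_zero]

end Slice

/-! ## §3 On `N` against ★ `heisHaar`: the `z`-coordinate is the matrix entry `u₀₂` -/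

section OnN

variable {J : Matrix (Fin 3) (Fin 3) R} (hJ : J = (StdForm.antidiagonal 3).over R)

omit [TopologicalSpace R] [IsTopologicalRing R] [LocallyCompactSpace R] [T2Space R] [SecondCountableTopology R] [MeasurableSpace R] [BorelSpace R] in
/-- **`z(u) = heisZ (heisX u) (heisY u) = u₀₂`**: the `z`-coordinate of the chart is the `(0,2)` matrix entry. [cite: Rogawski1990, §1.10 p. 9] -/
theorem heisZ_heisX_heisY (u : ↥(unipotentU σ J)) :
    heisZ σ (heisX σ u) ((heisY σ hσ hJ u : skewPart σ) : R) = (((u : ↥(unitaryGroupOfForm σ J)) : GL (Fin 3) R) : Matrix (Fin 3) (Fin 3) R) 0 2 := by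
  rw [heisZ, coe_heisY]; ring

variable (μX : Measure R) [μX.IsAddHaarMeasure] (μY : Measure (skewPart σ)) [μY.IsAddHaarMeasure] [μY.Regular]
  [MeasurableSpace ↥(unipotentU σ J)] [BorelSpace ↥(unipotentU σ J)]

omit [LocallyCompactSpace R] [T2Space R] [μX.IsAddHaarMeasure] [μY.IsAddHaarMeasure] [μY.Regular] in
/-- **Transport to `N`**: for every `Ψ : R → E`, `∫_N Ψ(u₀₂) d(heisHaar) = ∫_{μ_R ⊗ μ_{R⁻}} Ψ(heisZ x y)` (★ `heisHaar = (μ_R ⊗ μ_{R⁻}) ∘ chart⁻¹`). [cite: Rogawski1990, §1.10 p. 9] -/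
theorem integral_heisHaar_comp_entry {E : Type*} [NormedAddCommGroup E] [NormedSpace ℝ E] (Ψ : R → E) :
    ∫ u, Ψ ((((u : ↥(unitaryGroupOfForm σ J)) : GL (Fin 3) R) : Matrix (Fin 3) (Fin 3) R) 0 2) ∂(heisHaar σ hσ hσc hJ μX μY) =
      ∫ p, Ψ (heisZ σ p.1 (p.2 : R)) ∂(μX.prod μY) := by
  rw [heisHaar, show (μX.prod μY).map (heisHomeomorph σ hσ hσc hJ) = (μX.prod μY).map (heisHomeomorph σ hσ hσc hJ).toMeasurableEquiv from rfl,
    integral_map_equiv]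
  refine integral_congr_ae (Filter.Eventually.of_forall fun p => ?_)
  change Ψ ((((heisHomeomorph σ hσ hσc hJ p : ↥(unipotentU σ J)) : ↥(unitaryGroupOfForm σ J)) : GL (Fin 3) R) 0 2) = Ψ (heisZ σ p.1 (p.2 : R))
  rw [heisHomeomorph_apply, ← heisZ_heisX_heisY σ hσ hJ, heisX_heisElt, heisY_heisElt]

end OnN

end Summit.HodgeConjecture.HodgeConjecture.Cruxes.H413.F0P3cStCharTSHeisenbergAnnulusSlice

end
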